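import Literature.Probability.LatticeModels.SHolomorphicityProof

/-!
# The pair identity of the half-CR vertex relation at spin `1/3` (stub S2, part 2)

Helper file for the crux `CardySusyWard.ParafermionFamiliesToSLESix` (stmt-CriticalPhenomena-10814),
line `strip-anchored-vertex-normalisation`, stub `stub_halfCRVertexRelation` (S2: Duminil-Copin 2012,
Prop. 4 / Duminil-Copin–Smirnov 2012, Prop. 8.6 at `q = 1`).  The `q = 1`, spin-`1/3` analogue of
the tree's `PairIdentities.lean` (FK-Ising, spin `1/2`): pathwise, along the cut orbit of a
configuration, the dart carried by the coded corner `r` at time `j` weighs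
`sixthPhase (turnCount j) = exp(-iπ C_j / 6)`, and the half-CR combination at the edge `e = cTgt p`
(arriving corners `p`, `p₂ = cornerPartner p`; leaving corners `(p.1, p.2 + 1)`, `(p₂.1, p₂.2 + 1)`)
is `g = W(p.1, p.2+1) - W(p₂.1, p₂.2+1) - i (W p₂ - W p)` (`gval`).

* `gval_case0`: if neither arriving corner is a dart of the exploration, `g = 0`.
* `gval_case1`: if `p` is a dart of the exploration of `β`, `p₂` is not, and the loop `L` of `p₂` turns
  by `4 · turnSign β p` quarter turns (part 1), then `g(β) + g(β') = 0` for the toggled `β'`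
  (`cornerOrbit_toggle_case1`: `L` is spliced in); weights `λ^C, λ^{C+s}` in `β` and
  `λ^C, λ^{C-s}, λ^{C+2s}, λ^{C+s}` in `β'` (`s = turnSign β p`, `λ = e^{-iπ/6}`), identity `λ² + iλ = 1`.
-/

noncomputable section

namespace Summit.CriticalPhenomena.CardyFormulaZ2.Theorems.ParafermionFamiliesToSLESix.StripAnchored

open Finset Complex
open Literature.Probability.Percolation (BondConfig)
open Literature.Probability.LatticeModels

namespace S2

/-! ## The spin-`1/3` phases -/

/-- The spin-`1/3` weight of `n` quarter turns: `exp (-iπ n / 6)` (`exp(-(i/3) · (π/2) n)`).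
[cite: Smirnov2010, §2.2 eq. (2.2)] -/
def sixthPhase (n : ℤ) : ℂ := Complex.exp (((-(Real.pi / 6) * n : ℝ) : ℂ) * I)

/-- `sixthPhase` is additive-to-multiplicative. [folklore] -/
theorem sixthPhase_add (m n : ℤ) : sixthPhase (m + n) = sixthPhase m * sixthPhase n := by
  rw [sixthPhase, sixthPhase, sixthPhase, ← Complex.exp_add]; congr 1; push_cast; ring

/-- `sixthPhase 0 = 1`. [folklore] -/
@[simp] theorem sixthPhase_zero : sixthPhase 0 = 1 := by simp [sixthPhase]

/-- `λ λ̄ = 1`. [folklore] -/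
theorem sixthPhase_one_mul_neg_one : sixthPhase 1 * sixthPhase (-1) = 1 := by rw [← sixthPhase_add]; norm_num

/-- `sixthPhase n = cos (π n/6) - i sin (π n/6)`. [folklore] -/
theorem sixthPhase_eq (n : ℤ) :
    sixthPhase n = (Real.cos (Real.pi / 6 * n) : ℂ) - (Real.sin (Real.pi / 6 * n) : ℂ) * I := by
  rw [sixthPhase, show (-(Real.pi / 6) * n : ℝ) = -(Real.pi / 6 * n) by ring, Complex.exp_mul_I, ← Complex.ofReal_cos,
    ← Complex.ofReal_sin, Real.cos_neg, Real.sin_neg]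
  push_cast
  ring

/-- **The only trigonometric input: `λ - λ̄ = -i`** for `λ = e^{-iπ/6}`, i.e. `sin (π/6) = 1/2`.
[folklore] -/
theorem sixthPhase_one_sub : sixthPhase 1 - sixthPhase (-1) = -I := by
  have e1 : Real.pi / 6 * ((1 : ℤ) : ℝ) = Real.pi / 6 := by push_cast; ring
  have e2 : Real.pi / 6 * ((-1 : ℤ) : ℝ) = -(Real.pi / 6) := by push_cast; ring
  rw [sixthPhase_eq, sixthPhase_eq, e1, e2, Real.cos_neg, Real.sin_neg, Real.sin_pi_div_six]
  push_cast
  ring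

/-- The dart weight `exp(-(i/3) · ∑_{j<k} turnOf)` of the corner observable is `sixthPhase (turnCount k)`.
[cite: Smirnov2010, §2.2 eq. (2.2)] -/
theorem exp_turnOf_eq_sixthPhase (β : BondConfig (Site 2)) (c₀ : Site 2 × Fin 4) (k : ℕ) :
    Complex.exp (-(I / 3) * ((∑ j ∈ Finset.range k, turnOf β (cornerOrbit β c₀ j) : ℝ) : ℂ)) =
      sixthPhase (turnCount β c₀ k) := by
  rw [sum_turnOf_eq, sixthPhase, turnCount]
  congr 1
  push_cast
  ring

/-! ## Dart weights along a cut orbit, and the half-CR combination -/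

open scoped Classical in
/-- The total spin-`1/3` weight of the darts of the cut orbit (times `< N₀`) carried by the coded
corner `r`: `∑_{j<N₀, orb j = r} sixthPhase (turnCount j)` (at most one term for an exploration).
[cite: Smirnov2010, §2.2 eq. (2.2)] -/
def dartW (β₀ : BondConfig (Site 2)) (c₀ r : Site 2 × Fin 4) (N₀ : ℕ) : ℂ :=
  ∑ j ∈ (Finset.range N₀).filter (fun j => cornerOrbit β₀ c₀ j = r), sixthPhase (turnCount β₀ c₀ j)

/-- **The half-CR combination at the edge `cTgt p`**, pathwise: with `p₂ = cornerPartner p`,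
`W(p.1, p.2 + 1) - W(p₂.1, p₂.2 + 1) - i (W p₂ - W p)` — the leaving corner around the vertex of `p`
minus the leaving corner around the vertex of `p₂`, minus `i` times (arrival along `p₂` minus
arrival along `p`). [cite: DuminilCopin2012Parafermion, Proposition 4] -/
def gval (β₀ : BondConfig (Site 2)) (c₀ p : Site 2 × Fin 4) (N₀ : ℕ) : ℂ :=
  dartW β₀ c₀ (p.1, p.2 + 1) N₀ - dartW β₀ c₀ ((cornerPartner p).1, (cornerPartner p).2 + 1) N₀ -
    I * (dartW β₀ c₀ (cornerPartner p) N₀ - dartW β₀ c₀ p N₀)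

variable {β₀ : BondConfig (Site 2)} {c₀ : Site 2 × Fin 4}

/-- A corner that is no dart has weight `0`. [folklore] -/
theorem dartW_eq_zero {r : Site 2 × Fin 4} {N₀ : ℕ} (h : ∀ j < N₀, cornerOrbit β₀ c₀ j ≠ r) :
    dartW β₀ c₀ r N₀ = 0 := by
  classical
  unfold dartW
  refine Finset.sum_eq_zero fun j hj => ?_
  rw [Finset.mem_filter, Finset.mem_range] at hj
  exact absurd hj.2 (h j hj.1)

/-- A corner carried by exactly one dart, at time `i`, has weight `sixthPhase (turnCount i)`. [folklore] -/
theorem dartW_eq_single {r : Site 2 × Fin 4} {N₀ i : ℕ} (hi : i < N₀)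
    (h : ∀ j < N₀, cornerOrbit β₀ c₀ j = r ↔ j = i) : dartW β₀ c₀ r N₀ = sixthPhase (turnCount β₀ c₀ i) := by
  classical
  unfold dartW
  have : (Finset.range N₀).filter (fun j => cornerOrbit β₀ c₀ j = r) = {i} := by
    ext j
    simp only [Finset.mem_filter, Finset.mem_range, Finset.mem_singleton]
    exact ⟨fun hj => (h j hj.1).1 hj.2, fun hj => ⟨hj ▸ hi, (h j (hj ▸ hi)).2 hj⟩⟩
  rw [this, Finset.sum_singleton]

/-- Exchanging the two arriving corners changes the sign of the combination. [folklore] -/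
theorem gval_partner (β₀ : BondConfig (Site 2)) (c₀ p : Site 2 × Fin 4) (N₀ : ℕ) :
    gval β₀ c₀ (cornerPartner p) N₀ = -gval β₀ c₀ p N₀ := by
  unfold gval; rw [partner_partner]; ring

/-- The turn signs of the two corners arriving at an edge agree (same target edge). [folklore] -/
theorem turnSign_partner (β₀ : BondConfig (Site 2)) (p : Site 2 × Fin 4) :
    turnSign β₀ (cornerPartner p) = turnSign β₀ p := by
  classical
  unfold turnSign; rw [cTgt_partner]

/-! ## Leaving corners of an exploration come right after arriving ones -/
section Explorations

variable {D : DiscreteDobrushin} {ω : BondConfig (Site 2)} {p : Site 2 × Fin 4}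

local notation "β" => D.bcBondConfig ω
local notation "orb" => cornerOrbit (D.bcBondConfig ω) c₀

/-- **A dart leaving `e = cTgt p` is preceded by a dart arriving at `e`**: if `cSrc (orb j) = cTgt p`
and no endpoint of `e` lies on the arc `B` (so `e ≠ e_a`), then `j = j' + 1` with
`orb j' ∈ {p, cornerPartner p}` and `orb j = nextCorner β (orb j')`. [cite: Smirnov2001, §2] -/
theorem exists_pred_of_cSrc_eq (hc₀ : D.IsStartCorner c₀) (hB : ∀ x ∈ cTgt p, x ∉ D.zdArcB) {j : ℕ}
    (hj : cSrc (orb j) = cTgt p) :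
    ∃ j', j = j' + 1 ∧ (orb j' = p ∨ orb j' = cornerPartner p) := by
  rcases j with _ | j'
  · exact absurd hc₀.mem_zdArcB (hB _ (hj ▸ Sym2.mem_mk_right _ _))
  · refine ⟨j', rfl, ?_⟩
    rw [cSrc_cornerOrbit_succ] at hj
    exact cTgt_eq_cTgt_iff.1 hj

/-- The two leaving corners are the successors of the two arriving corners. [folklore] -/
theorem cSrc_eq_of_leaving (r : Site 2 × Fin 4) (hr : r = (p.1, p.2 + 1) ∨ r = ((cornerPartner p).1, (cornerPartner p).2 + 1)) :
    cSrc r = cTgt p := by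
  rcases hr with rfl | rfl
  · exact (cTgt_crossPred (p.1, p.2 + 1)).symm.trans (by rw [fin4_add_one_add_three])
  · rw [← cTgt_partner p]
    exact (cTgt_crossPred ((cornerPartner p).1, (cornerPartner p).2 + 1)).symm.trans (by rw [fin4_add_one_add_three])

/-- **Case 0**: if neither corner arriving at `e` is a dart of the exploration (times `< N`), the
half-CR combination vanishes (no dart arrives at or leaves `e`). [cite: DuminilCopin2012Parafermion, Proposition 4] -/
theorem gval_case0 (hc₀ : D.IsStartCorner c₀) (hB : ∀ x ∈ cTgt p, x ∉ D.zdArcB) {N : ℕ}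
    (h₁ : ∀ i < N, orb i ≠ p) (h₂ : ∀ i < N, orb i ≠ cornerPartner p) : gval β c₀ p N = 0 := by
  have hleave : ∀ r : Site 2 × Fin 4, (r = (p.1, p.2 + 1) ∨ r = ((cornerPartner p).1, (cornerPartner p).2 + 1)) →
      ∀ j < N, orb j ≠ r := by
    intro r hr j hj hjr
    obtain ⟨j', rfl, h⟩ := exists_pred_of_cSrc_eq hc₀ hB (hjr ▸ cSrc_eq_of_leaving r hr)
    rcases h with h | h
    · exact h₁ j' (by omega) h
    · exact h₂ j' (by omega) h
  unfold gval
  rw [dartW_eq_zero (hleave _ (Or.inl rfl)), dartW_eq_zero (hleave _ (Or.inr rfl)), dartW_eq_zero h₁, dartW_eq_zero h₂]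
  ring

end Explorations

/-! ## Case 1: the loop of the partner is spliced in -/
section Case1

variable {D : DiscreteDobrushin} {ω ω' : BondConfig (Site 2)} {c₀ p : Site 2 × Fin 4}

local notation "β" => D.bcBondConfig ω
local notation "β'" => D.bcBondConfig ω'
local notation "orb" => cornerOrbit (D.bcBondConfig ω) c₀
local notation "orb'" => cornerOrbit (D.bcBondConfig ω') c₀

/-- **The pair identity, case 1.** `p = orb i₁` is a dart of the exploration of `ω` but its partner
`p₂` is not; `β`, `β'` agree off `e = cTgt p` and differ at `e`; all faces at both endpoints of `e` are
inner; the loop `L` of `p₂` under `β` (minimal period `Q`) turns by `4 · turnSign β p`.  Then the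
half-CR combinations of the two explorations (the second has `L` spliced in and exits at `N + Q`)
cancel: `g(β, N) + g(β', N + Q) = 0`. [cite: DuminilCopin2012Parafermion, Proposition 4]
[cite: DuminilCopinSmirnov2012Lattice, Proposition 8.6] -/
theorem gval_case1 (hD : D.IsZdAdmissible) (hc₀ : D.IsStartCorner c₀)
    (hagree : ∀ e, e ≠ cTgt p → (e ∈ β' ↔ e ∈ β)) (hdiff : ¬ (cTgt p ∈ β' ↔ cTgt p ∈ β))
    (hB : ∀ x ∈ cTgt p, x ∉ D.zdArcB)
    (hx : ∀ j, D.IsInnerFace (faceAt p.1 j)) (hy : ∀ j, D.IsInnerFace (faceAt (p.1 + cornerUnit (p.2 + 1)) j))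
    {N P Q i₁ : ℕ} (hN : ¬ D.IsInnerFace (cFace (orb N))) (hlt : ∀ k < N, D.IsInnerFace (cFace (orb k)))
    (hP0 : 0 < P) (hP : orb P = c₀) (hPmin : ∀ s, 0 < s → s < P → orb s ≠ c₀)
    (hQ0 : 0 < Q) (hQ : cornerOrbit β (cornerPartner p) Q = cornerPartner p)
    (hQmin : ∀ s, 0 < s → s < Q → cornerOrbit β (cornerPartner p) s ≠ cornerPartner p)
    (hi₁ : orb i₁ = p) (hi₁N : i₁ < N) (h₂ : ∀ i < N, orb i ≠ cornerPartner p)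
    (hS : ∑ m ∈ Finset.range Q, turnSign β (cornerOrbit β (cornerPartner p) m) = 4 * turnSign β p) :
    gval β c₀ p N + gval β' c₀ p (N + Q) = 0 := by
  classical
  set p₂ := cornerPartner p with hp₂
  have hinj : ∀ a b, a < N → b < N → orb a = orb b → a = b := by
    intro a b ha hb h
    by_contra hne
    rcases Nat.lt_or_gt_of_ne hne with hab | hab
    · exact cornerOrbit_ne hD hc₀ hab (fun k hk => hlt k (by omega)) h
    · exact cornerOrbit_ne hD hc₀ hab (fun k hk => hlt k (by omega)) h.symm
  -- the loop never meets the interface cycle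
  have hdisj : ∀ m s, cornerOrbit β p₂ m ≠ orb s := fun m s =>
    loop_ne_of_never_arrives hD hc₀ hy hN hlt hP0 hP hPmin h₂ m s
  obtain ⟨hpre, hloop, htail, hin', hout'⟩ := cornerOrbit_toggle_case1 hD hc₀ hagree hdiff hx hy hN hlt hP0 hP hPmin hQ0 hQ
    hQmin hi₁ hi₁N h₂
  have hB' : ∀ x ∈ cTgt p₂, x ∉ D.zdArcB := by rw [hp₂, cTgt_partner]; exact hB
  -- ### the darts of `β` at `e`
  have hsucc : orb (i₁ + 1) = nextCorner β p := by rw [← hi₁]; rfl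
  have hi₁N' : i₁ + 1 < N := by
    refine lt_of_le_of_ne (by omega) fun h => hN ?_
    rw [← h, hsucc]
    by_cases he : cTgt p ∈ β
    · rw [cFace_nextCorner_of_mem he]; exact hx p.2
    · rw [cFace_nextCorner_of_not_mem he]; exact hx _
  have uP : ∀ j < N, orb j = p ↔ j = i₁ := fun j hj =>
    ⟨fun h => hinj j i₁ hj hi₁N (h.trans hi₁.symm), fun h => h ▸ hi₁⟩
  have uS : ∀ j < N, orb j = nextCorner β p ↔ j = i₁ + 1 := by
    intro j hj
    refine ⟨fun h => ?_, fun h => h ▸ hsucc⟩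
    obtain ⟨j', rfl, hj'⟩ := exists_pred_of_cSrc_eq hc₀ hB (by rw [h, cSrc_nextCorner])
    rcases hj' with hj' | hj'
    · rw [(uP j' (by omega)).1 hj']
    · exact absurd hj' (h₂ j' (by omega))
  have zS : ∀ j < N, orb j ≠ nextCorner β p₂ := by
    intro j hj h
    obtain ⟨j', rfl, hj'⟩ := exists_pred_of_cSrc_eq hc₀ hB (by rw [h, cSrc_nextCorner, hp₂, cTgt_partner])
    rcases hj' with hj' | hj'
    · have : nextCorner β p = nextCorner β p₂ := by rw [← hj', ← h]; rfl
      exact partner_ne p (nextCorner_injective this).symm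
    · exact h₂ j' (by omega) hj'
  -- ### the darts of `β'` at `e` (exit time `N + Q`)
  have hloopQ : orb' (i₁ + Q) = p₂ := by
    have := hloop (Q - 1) (by omega)
    rwa [show i₁ + 1 + (Q - 1) = i₁ + Q by omega, Nat.sub_add_cancel hQ0, hQ] at this
  -- classification of the times `< N + Q`
  have hcls : ∀ j < N + Q, (j ≤ i₁ ∧ orb' j = orb j) ∨ (i₁ < j ∧ j ≤ i₁ + Q ∧ orb' j = cornerOrbit β p₂ (j - i₁)) ∨
      (i₁ + Q < j ∧ orb' j = orb (j - Q)) := by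
    intro j hj
    by_cases hj1 : j ≤ i₁
    · exact Or.inl ⟨hj1, hpre j hj1⟩
    · by_cases hj2 : j ≤ i₁ + Q
      · refine Or.inr (Or.inl ⟨by omega, hj2, ?_⟩)
        have := hloop (j - i₁ - 1) (by omega)
        rwa [show i₁ + 1 + (j - i₁ - 1) = j by omega, show j - i₁ - 1 + 1 = j - i₁ by omega] at this
      · refine Or.inr (Or.inr ⟨by omega, ?_⟩)
        have := htail (j - i₁ - Q - 1) (by omega)
        rwa [show i₁ + Q + 1 + (j - i₁ - Q - 1) = j by omega, show i₁ + 1 + (j - i₁ - Q - 1) = j - Q by omega] at this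
  have uP' : ∀ j < N + Q, orb' j = p ↔ j = i₁ := by
    intro j hj
    refine ⟨fun h => ?_, fun h => by rw [h, hpre i₁ le_rfl, hi₁]⟩
    rcases hcls j hj with ⟨hj1, hoj⟩ | ⟨hj1, hj2, hoj⟩ | ⟨hj1, hoj⟩
    · exact (uP j (by omega)).1 (hoj ▸ h)
    · exact absurd ((hoj.symm.trans h).trans hi₁.symm) (hdisj _ _)
    · have := (uP (j - Q) (by omega)).1 (hoj ▸ h); omega
  have uP₂' : ∀ j < N + Q, orb' j = p₂ ↔ j = i₁ + Q := by
    intro j hj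
    refine ⟨fun h => ?_, fun h => h ▸ hloopQ⟩
    rcases hcls j hj with ⟨hj1, hoj⟩ | ⟨hj1, hj2, hoj⟩ | ⟨hj1, hoj⟩
    · exact absurd (hoj ▸ h) (h₂ j (by omega))
    · by_contra hne
      exact hQmin (j - i₁) (by omega) (by omega) (hoj.symm.trans h)
    · exact absurd (hoj ▸ h) (h₂ (j - Q) (by omega))
  have hsucc' : orb' (i₁ + 1) = nextCorner β' p := by rw [← (uP' i₁ (by omega)).2 rfl]; rfl
  have hsucc₂' : orb' (i₁ + Q + 1) = nextCorner β' p₂ := by rw [← hloopQ]; rfl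
  have hnext' : nextCorner β' p = nextCorner β p₂ := by
    rw [nextCorner_toggle hagree hdiff, Equiv.swap_apply_left]
  have hnext₂' : nextCorner β' p₂ = nextCorner β p := by
    rw [nextCorner_toggle hagree hdiff, hp₂, Equiv.swap_apply_right]
  have uS' : ∀ j < N + Q, orb' j = nextCorner β' p ↔ j = i₁ + 1 := by
    intro j hj
    refine ⟨fun h => ?_, fun h => h ▸ hsucc'⟩
    obtain ⟨j', rfl, hj'⟩ := exists_pred_of_cSrc_eq (ω := ω') hc₀ hB (by rw [h, cSrc_nextCorner])
    rcases hj' with hj' | hj'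
    · rw [(uP' j' (by omega)).1 hj']
    · have hn : nextCorner β' p₂ = nextCorner β' p := by rw [hp₂, ← hj', ← h]; rfl
      exact absurd (nextCorner_injective hn) (partner_ne p)
  have uS₂' : ∀ j < N + Q, orb' j = nextCorner β' p₂ ↔ j = i₁ + Q + 1 := by
    intro j hj
    refine ⟨fun h => ?_, fun h => h ▸ hsucc₂'⟩
    obtain ⟨j', rfl, hj'⟩ := exists_pred_of_cSrc_eq (ω := ω') hc₀ hB' (by rw [h, cSrc_nextCorner])
    rw [hp₂, partner_partner] at hj'
    rcases hj' with hj' | hj'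
    · rw [(uP₂' j' (by omega)).1 hj']
    · have hn : nextCorner β' p = nextCorner β' p₂ := by rw [← hj', ← h]; rfl
      exact absurd (nextCorner_injective hn).symm (partner_ne p)
  -- ### turn counts
  set C := turnCount β c₀ i₁ with hC
  have he'iff : cTgt p ∈ β' ↔ cTgt p ∉ β := by
    constructor
    · exact fun h' h => hdiff ⟨fun _ => h, fun _ => h'⟩
    · intro h; by_contra h'; exact hdiff ⟨fun h'' => absurd h'' h', fun h'' => absurd h'' h⟩
  have htgt : ∀ j < N, j ≠ i₁ → cTgt (orb j) ≠ cTgt p := by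
    intro j hj h1 h
    rcases cTgt_eq_cTgt_iff.1 h with h | h
    · exact h1 (hinj j i₁ hj hi₁N (h.trans hi₁.symm))
    · exact h₂ j hj h
  have hC' : turnCount β' c₀ i₁ = C :=
    turnCount_congr_prefix hpre fun j hj => hagree _ (htgt j (by omega) (by omega))
  have hLtgt : ∀ m, 0 < m → m < Q → cTgt (cornerOrbit β p₂ m) ≠ cTgt p := by
    intro m hm hmQ h
    rcases cTgt_eq_cTgt_iff.1 h with h | h
    · exact hdisj m i₁ (h.trans hi₁.symm)
    · exact hQmin m hm hmQ h
  have hS1 : ∑ m ∈ Finset.range (Q - 1), turnSign β (cornerOrbit β p₂ (m + 1)) = 3 * turnSign β p := by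
    have h := hS
    rw [show Q = (Q - 1) + 1 by omega, Finset.sum_range_succ'] at h
    have h0 : turnSign β (cornerOrbit β p₂ 0) = turnSign β p := turnSign_partner β p
    rw [h0] at h
    linear_combination h
  have hCQ' : turnCount β' c₀ (i₁ + Q) = C + turnSign β' p + 3 * turnSign β p := by
    rw [turnCount_add, show Q = (Q - 1) + 1 by omega, Finset.sum_range_succ', add_zero,
      hpre i₁ le_rfl, hi₁, hC', ← hS1]
    have hterm : ∀ m ∈ Finset.range (Q - 1), turnSign β' (orb' (i₁ + (m + 1))) = turnSign β (cornerOrbit β p₂ (m + 1)) := by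
      intro m hm
      rw [Finset.mem_range] at hm
      rw [show i₁ + (m + 1) = i₁ + 1 + m by omega, hloop m (by omega)]
      exact turnSign_congr (hagree _ (hLtgt (m + 1) (Nat.succ_pos _) (by omega)))
    rw [Finset.sum_congr rfl hterm]
    ring
  have hCs : turnCount β c₀ (i₁ + 1) = C + turnSign β p := by rw [turnCount_succ, hi₁]
  have hCs' : turnCount β' c₀ (i₁ + 1) = C + turnSign β' p := by rw [turnCount_succ, hpre i₁ le_rfl, hi₁, hC']
  have hCQs' : turnCount β' c₀ (i₁ + Q + 1) = C + turnSign β' p + 3 * turnSign β p + turnSign β' p := by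
    rw [turnCount_succ, hloopQ, hCQ', turnSign_partner]
  -- ### the weights
  have wP : dartW β c₀ p N = sixthPhase C := dartW_eq_single hi₁N uP
  have wP₂ : dartW β c₀ p₂ N = 0 := dartW_eq_zero h₂
  have wS : dartW β c₀ (nextCorner β p) N = sixthPhase (C + turnSign β p) := by
    rw [dartW_eq_single hi₁N' uS, hCs]
  have wS₂ : dartW β c₀ (nextCorner β p₂) N = 0 := dartW_eq_zero zS
  have wP' : dartW β' c₀ p (N + Q) = sixthPhase C := by rw [dartW_eq_single (by omega) uP', hC']
  have wP₂' : dartW β' c₀ p₂ (N + Q) = sixthPhase (C + turnSign β' p + 3 * turnSign β p) := by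
    rw [dartW_eq_single (by omega) uP₂', hCQ']
  have wS' : dartW β' c₀ (nextCorner β p₂) (N + Q) = sixthPhase (C + turnSign β' p) := by
    rw [← hnext', dartW_eq_single (by omega) uS', hCs']
  have wS₂' : dartW β' c₀ (nextCorner β p) (N + Q) = sixthPhase (C + turnSign β' p + 3 * turnSign β p + turnSign β' p) := by
    rw [← hnext₂', dartW_eq_single (by omega) uS₂', hCQs']
  -- ### the algebra, in the two cases `e` closed / open in `β`
  have key := sixthPhase_one_sub; have key1 := sixthPhase_one_mul_neg_one
  by_cases he : cTgt p ∈ β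
  · -- `e` open in `β`: `p` is followed, `s = -1`
    have he' : cTgt p ∉ β' := fun h => (he'iff.1 h) he
    have hs : turnSign β p = -1 := turnSign_of_mem he
    have hs' : turnSign β' p = 1 := turnSign_of_not_mem he'
    have n1 : nextCorner β p = (p₂.1, p₂.2 + 1) := by
      rw [nextCorner_of_mem he, hp₂, cornerPartner]; simp only; rw [fin4_add_two_add_one]
    have n2 : nextCorner β p₂ = (p.1, p.2 + 1) := nextCorner_partner_of_mem he
    rw [hs] at wS
    rw [hs, hs'] at wP₂' wS₂'
    rw [hs'] at wS'
    unfold gval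
    rw [← hp₂, ← n1, ← n2, wP, wP₂, wS, wS₂, wP', wP₂', wS', wS₂']
    have e1 : sixthPhase (C + -1) = sixthPhase C * sixthPhase (-1) := sixthPhase_add _ _
    have e2 : sixthPhase (C + 1) = sixthPhase C * sixthPhase 1 := sixthPhase_add _ _
    have e3 : sixthPhase (C + 1 + 3 * -1) = sixthPhase C * (sixthPhase (-1) * sixthPhase (-1)) := by
      rw [← sixthPhase_add, ← sixthPhase_add]; congr 1; ring
    have e4 : sixthPhase (C + 1 + 3 * -1 + 1) = sixthPhase C * sixthPhase (-1) := by
      rw [← sixthPhase_add]; congr 1; ring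
    rw [e1, e2, e3, e4]
    linear_combination (sixthPhase C * (1 + I * sixthPhase (-1))) * key + (-(sixthPhase C * I)) * key1 +
      (-(sixthPhase C * sixthPhase (-1))) * Complex.I_mul_I
  · -- `e` closed in `β`: `p` crosses, `s = +1`
    have he' : cTgt p ∈ β' := he'iff.2 he
    have hs : turnSign β p = 1 := turnSign_of_not_mem he
    have hs' : turnSign β' p = -1 := turnSign_of_mem he'
    have n1 : nextCorner β p = (p.1, p.2 + 1) := nextCorner_of_not_mem he
    have n2 : nextCorner β p₂ = (p₂.1, p₂.2 + 1) := by
      rw [hp₂, nextCorner_partner_of_not_mem he, cornerPartner]; simp only; rw [fin4_add_two_add_one]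
    rw [hs] at wS
    rw [hs, hs'] at wP₂' wS₂'
    rw [hs'] at wS'
    unfold gval
    rw [← hp₂, ← n1, ← n2, wP, wP₂, wS, wS₂, wP', wP₂', wS', wS₂']
    have e1 : sixthPhase (C + -1) = sixthPhase C * sixthPhase (-1) := sixthPhase_add _ _
    have e2 : sixthPhase (C + 1) = sixthPhase C * sixthPhase 1 := sixthPhase_add _ _
    have e3 : sixthPhase (C + -1 + 3 * 1) = sixthPhase C * (sixthPhase 1 * sixthPhase 1) := by
      rw [← sixthPhase_add, ← sixthPhase_add]; congr 1; ring
    have e4 : sixthPhase (C + -1 + 3 * 1 + -1) = sixthPhase C * sixthPhase 1 := by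
      rw [← sixthPhase_add]; congr 1; ring
    rw [e1, e2, e3, e4]
    linear_combination (sixthPhase C * (1 - I * sixthPhase 1)) * key + (-(sixthPhase C * I)) * key1 +
      (sixthPhase C * sixthPhase 1) * Complex.I_mul_I

end Case1

end S2

/-- **Registered one-line form of the pair identity** `S2.gval_case1` (sub-goal `stub_halfCR_pairing` of
stmt-CriticalPhenomena-10814, part 2 of stub S2). [cite: DuminilCopin2012Parafermion, Proposition 4] -/
theorem stub_halfCR_pairing : ∀ (D : DiscreteDobrushin) (ω ω' : BondConfig (Site 2)) (c₀ p : Site 2 × Fin 4) (N P Q i₁ : ℕ), D.IsZdAdmissible → D.IsStartCorner c₀ → (∀ e, e ≠ cTgt p → (e ∈ D.bcBondConfig ω' ↔ e ∈ D.bcBondConfig ω)) → ¬ (cTgt p ∈ D.bcBondConfig ω' ↔ cTgt p ∈ D.bcBondConfig ω) → (∀ x ∈ cTgt p, x ∉ D.zdArcB) → (∀ j, D.IsInnerFace (faceAt p.1 j)) → (∀ j, D.IsInnerFace (faceAt (p.1 + cornerUnit (p.2 + 1)) j)) → ¬ D.IsInnerFace (cFace (cornerOrbit (D.bcBondConfig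 ω) c₀ N)) → (∀ k < N, D.IsInnerFace (cFace (cornerOrbit (D.bcBondConfig ω) c₀ k))) → 0 < P → cornerOrbit (D.bcBondConfig ω) c₀ P = c₀ → (∀ s, 0 < s → s < P → cornerOrbit (D.bcBondConfig ω) c₀ s ≠ c₀) → 0 < Q → cornerOrbit (D.bcBondConfig ω) (cornerPartner p) Q = cornerPartner p → (∀ s, 0 < s → s < Q → cornerOrbit (D.bcBondConfig ω) (cornerPartner p) s ≠ cornerPartner p) → cornerOrbit (D.bcBondConfig ω) c₀ i₁ = p → i₁ < N → (∀ i < N, cornerOrbit (D.bcBondConfig ω) c₀ i ≠ cornerPartner p) → ∑ m ∈ Finset.range Q, turnSign (D.bcBondConfig ω) (cornerOrbit (D.bcBondConfig ω) (cornerPartner p) m) = 4 * turnSign (D.bcBondConfig ω) p → S2.gval (D.bcBondConfig ω) c₀ p N + S2.gval (D.bcBondConfig ω') c₀ p (N + Q) = 0 :=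
  fun _ _ _ _ _ _ _ _ _ hD hc₀ hagree hdiff hB hx hy hN hlt hP0 hP hPmin hQ0 hQ hQmin hi₁ hi₁N h₂ hS =>
    S2.gval_case1 hD hc₀ hagree hdiff hB hx hy hN hlt hP0 hP hPmin hQ0 hQ hQmin hi₁ hi₁N h₂ hS

end Summit.CriticalPhenomena.CardyFormulaZ2.Theorems.ParafermionFamiliesToSLESix.StripAnchored

end
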